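import Literature.Probability.LatticeModels.DartPhase
import Literature.Probability.LatticeModels.DirichletGreenFunction
import Literature.Probability.RandomPlanarGeometry.PlanarDomains
import Summits.CriticalPhenomena.CardyFormulaZ2.Theorems.CardySusyWardParafermionPrecompactKenyonDefs
import Literature.Probability.RandomPlanarGeometry.HopfClosed

/-!
# Hopf's Umlaufsatz with its sign (helper for stub `stub_vertexRelation`)

Line `kenyon-stream-second-relation` of the crux `ParafermionPrecompact` (route `CardySusyWard`,
item stmt-CriticalPhenomena-11293). The tree's discrete Hopf Umlaufsatz `hopf_closed`
(`RandomPlanarGeometry/HopfClosed.lean`; H. Hopf, Compositio Math. 2 (1935), Satz I, discretised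
through the secant homotopy `hopf_open`) concludes that the total turning of a closed polygon
with short edges, based at a lowest vertex `z₀`, is `2π ∨ -2π`; its proof actually DECIDES the
alternative: `+2π` iff `arg (z₁ - z₀) ≤ arg (z_{n-1} - z₀)`. This file records that signed form
(`hopf_closed_signed`, verbatim the tree's proof with the last step split into the two
implications). It is the analytic input of the signed Umlaufsatz for simple closed lattice walks
(`…SignedUmlaufsatz.lean`), needed to ORIENT the loops excised by the one-edge involution in the
proof of the vertex relation at spin `1/3` (for Smirnov's `σ = 1/2` both orientations give the
same phase `-1`, which is why the FK-Ising programme of the tree only needed `±4`).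

References: H. Hopf, *Über die Drehung der Tangenten und Sehnen ebener Kurven*, Compositio
Math. 2 (1935), Satz I [Hopf1935].
-/

noncomputable section

namespace Summit.CriticalPhenomena.CardyFormulaZ2.Cruxes.ParafermionPrecompact.KenyonStreamSecondRelation

open Complex Finset Real
open _root_.Literature.Probability.RandomPlanarGeometry.SAW.Hopf

/-! ### Hopf's Umlaufsatz with its sign -/

/-- **Signed discrete Hopf Umlaufsatz.** Under the hypotheses of the tree's `hopf_closed`
(pairwise distinct `z₀, …, z_{n-1}`, `n ≥ 3`, closed up periodically, every edge seen from every
other vertex under an angle `< π/2`, `z₀` a lowest vertex), the total turning is `2π` if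
`arg (z₁ - z₀) ≤ arg (z_{n-1} - z₀)` and `-2π` otherwise. (Verbatim the tree's proof of
`hopf_closed`, which ends by deciding this alternative.) [cite: Hopf1935, Satz I] -/
theorem hopf_closed_signed :
    ∀ (z : ℕ → ℂ) (n : ℕ), 3 ≤ n → z n = z 0 → z (n + 1) = z 1 →
      (∀ i j : ℕ, i < n → j < n → z i = z j → i = j) →
      (∀ k j : ℕ, k < n → j < n → z j ≠ z k → z j ≠ z (k + 1) →
        0 < ((z (k + 1) - z j) * (starRingEnd ℂ) (z k - z j)).re) →
      (∀ j < n, 0 ≤ (z j - z 0).im) →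
        (Complex.arg (z 1 - z 0) ≤ Complex.arg (z (n - 1) - z 0) →
          ∑ v ∈ Finset.range n, ((Complex.arg (z (v + 2) - z (v + 1)) : Real.Angle) -
            (Complex.arg (z (v + 1) - z v) : Real.Angle)).toReal = 2 * Real.pi) ∧
        (Complex.arg (z (n - 1) - z 0) < Complex.arg (z 1 - z 0) →
          ∑ v ∈ Finset.range n, ((Complex.arg (z (v + 2) - z (v + 1)) : Real.Angle) -
            (Complex.arg (z (v + 1) - z v) : Real.Angle)).toReal = -(2 * Real.pi)) := by
  intro z n hn hzn hzn1 hinj hsub hbot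
  obtain ⟨M, rfl⟩ : ∃ M, n = M + 3 := ⟨n - 3, by omega⟩
  have hne : ∀ i j : ℕ, i < M + 3 → j < M + 3 → i ≠ j → z i ≠ z j :=
    fun i j hi hj hij h => hij (hinj i j hi hj h)
  have hz3 : z (M + 1 + 2) = z 0 := hzn
  have hz3' : z (M + 2 + 1) = z 0 := hzn
  have hz4 : z (M + 2 + 2) = z 1 := hzn1
  -- exterior angles `E`, fans into `z_{M+2}` (`X`), from `z₀` (`W`), into `z₀` (`Y`), rungs `Z`
  set E : ℕ → ℝ := fun v => ((Complex.arg (z (v + 2) - z (v + 1)) : Angle) -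
      (Complex.arg (z (v + 1) - z v) : Angle)).toReal with hE
  set X : ℕ → ℝ := fun i => ((Complex.arg (z (M + 2) - z (i + 1)) : Angle) -
      (Complex.arg (z (M + 2) - z i) : Angle)).toReal with hX
  set W : ℕ → ℝ := fun i => ((Complex.arg (z (i + 2) - z 0) : Angle) -
      (Complex.arg (z (i + 1) - z 0) : Angle)).toReal with hW
  set Y : ℕ → ℝ := fun i => ((Complex.arg (z 0 - z (i + 1)) : Angle) -
      (Complex.arg (z 0 - z i) : Angle)).toReal with hY
  set Z : ℕ → ℝ := fun i => ((Complex.arg (z 0 - z i) : Angle) -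
      (Complex.arg (z (M + 2) - z i) : Angle)).toReal with hZ
  -- Hopf's identity for the open path `z₀, …, z_{M+2}`
  have hopen : ∑ j ∈ range (M + 1), E j = ∑ i ∈ range (M + 1), X i + ∑ i ∈ range (M + 1), W i :=
    hopf_open z (M + 1) (fun k j hk hj h1 h2 => hsub k j (by omega) (by omega)
      (hne j k (by omega) (by omega) h1) (hne j (k + 1) (by omega) (by omega) h2))
  -- the subtended-angle bounds
  have hre : ∀ v w : ℂ, ((-v) * (starRingEnd ℂ) (-w)).re = (v * (starRingEnd ℂ) w).re := by
    intro v w; simp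
  have bX : ∀ i ≤ M, |X i| < π / 2 := by
    intro i hi
    apply abs_toReal_argDiff_lt
    have := hsub i (M + 2) (by omega) (by omega) (hne _ _ (by omega) (by omega) (by omega))
      (hne _ _ (by omega) (by omega) (by omega))
    rwa [← hre, neg_sub, neg_sub] at this
  have bW : ∀ i ≤ M, |W i| < π / 2 := by
    intro i hi
    apply abs_toReal_argDiff_lt
    exact hsub (i + 1) 0 (by omega) (by omega) (hne _ _ (by omega) (by omega) (by omega))
      (hne _ _ (by omega) (by omega) (by omega))
  have bY : ∀ i, 1 ≤ i → i ≤ M + 1 → |Y i| < π / 2 := by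
    intro i h1 h2
    apply abs_toReal_argDiff_lt
    have := hsub i 0 (by omega) (by omega) (hne _ _ (by omega) (by omega) (by omega))
      (hne _ _ (by omega) (by omega) (by omega))
    rwa [← hre, neg_sub, neg_sub] at this
  have bZ : ∀ i, 1 ≤ i → i ≤ M + 1 → |Z i| < π / 2 := by
    intro i h1 h2
    apply abs_toReal_argDiff_lt
    have := hsub (M + 2) i (by omega) (by omega) (hne _ _ (by omega) (by omega) (by omega))
      (by rw [hz3']; exact hne _ _ (by omega) (by omega) (by omega))
    rwa [hz3'] at this
  -- plaquettes of the strip between the fan into `z_{M+2}` and the fan into `z_{M+3} = z₀`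
  have plaq : ∀ i, 1 ≤ i → i ≤ M → X i + Z (i + 1) = Z i + Y i := by
    intro i h1 h2
    apply toReal_add_eq_toReal_add _ (bX i h2) (bZ (i + 1) (by omega) (by omega)) (bZ i h1 (by omega))
      (bY i h1 (by omega))
    abel
  have hstrip : ∑ i ∈ range M, X (i + 1) + (Z (M + 1) - Z (0 + 1)) = ∑ i ∈ range M, Y (i + 1) := by
    rw [← Finset.sum_range_sub (fun i => Z (i + 1)) M, ← sum_add_distrib]
    refine sum_congr rfl fun i hi => ?_
    rw [mem_range] at hi
    have := plaq (i + 1) (by omega) (by omega)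
    linarith
  -- the two triangles at the ends of the strip
  have top : Z (M + 1) + Y (M + 1) = E (M + 1) := by
    have hz := bZ (M + 1) (by omega) le_rfl
    have hy := bY (M + 1) (by omega) le_rfl
    simp only [hZ, hY, hE] at hz hy ⊢
    rw [← toReal_add_of_lt hz hy, hz3, show M + 1 + 1 = M + 2 from rfl]
    congr 1
    abel
  have bot : X 0 + Z 1 = E (M + 2) := by
    have hx := bX 0 (Nat.zero_le _)
    have hz := bZ 1 le_rfl (by omega)
    simp only [hX, hZ, hE] at hx hz ⊢
    rw [← toReal_add_of_lt hx hz, hz4, hz3', show (0 : ℕ) + 1 = 1 from rfl]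
    have h01 : z 0 - z 1 ≠ 0 := sub_ne_zero.2 (hne _ _ (by omega) (by omega) (by omega))
    have hM0 : z (M + 2) - z 0 ≠ 0 := sub_ne_zero.2 (hne _ _ (by omega) (by omega) (by omega))
    rw [show z 1 - z 0 = -(z 0 - z 1) by ring, show z 0 - z (M + 2) = -(z (M + 2) - z 0) by ring,
      argDiff_neg_neg h01 hM0]
    congr 1
    abel
  -- the two fans at the lowest vertex are differences of arguments
  set a : ℝ := Complex.arg (z 1 - z 0) with ha
  set b : ℝ := Complex.arg (z (M + 2) - z 0) with hb
  have hFW : ∑ i ∈ range (M + 1), W i = b - a := by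
    have h := sum_toReal_argDiff_eq (c := 1) one_ne_zero (fun i => z (i + 1) - z 0) (M + 1)
      (fun i _ => sub_ne_zero.2 (hne _ _ (by omega) (by omega) (by omega)))
      (fun i _ => by rw [one_mul]; exact hbot (i + 1) (by omega))
      (fun i hi => lt_of_lt_of_le (bW i (by omega)) (by linarith [Real.pi_pos]))
    rw [one_mul, one_mul] at h
    exact h
  have hFY : ∑ i ∈ range (M + 1), Y (i + 1) = b - a := by
    have h := sum_toReal_argDiff_eq (c := -1) (by norm_num) (fun i => z 0 - z (i + 1)) (M + 1)
      (fun i _ => sub_ne_zero.2 (hne _ _ (by omega) (by omega) (by omega)))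
      (fun i _ => by rw [neg_one_mul, neg_sub]; exact hbot (i + 1) (by omega))
      (fun i hi => lt_of_lt_of_le (bY (i + 1) (by omega) (by omega)) (by linarith [Real.pi_pos]))
    rw [neg_one_mul, neg_one_mul, neg_sub, neg_sub] at h
    exact h
  -- assemble: total turning = 2 ∡(z₀) + 2 (b - a)
  have hXs : ∑ i ∈ range (M + 1), X i = ∑ i ∈ range M, X (i + 1) + X 0 := Finset.sum_range_succ' X M
  have hYs : ∑ i ∈ range (M + 1), Y (i + 1) = ∑ i ∈ range M, Y (i + 1) + Y (M + 1) :=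
    Finset.sum_range_succ (fun i => Y (i + 1)) M
  have hS : ∑ v ∈ range (M + 3), E v = ∑ j ∈ range (M + 1), E j + E (M + 1) + E (M + 2) := by
    rw [Finset.sum_range_succ, Finset.sum_range_succ]
  have htot : ∑ v ∈ range (M + 3), E v = 2 * E (M + 2) + 2 * (b - a) := by
    simp only [show (0 : ℕ) + 1 = 1 from rfl] at hstrip
    linarith
  -- the exterior angle at the lowest vertex
  have h0a : 0 ≤ a := Complex.arg_nonneg_iff.2 (hbot 1 (by omega))
  have hapi : a ≤ π := Complex.arg_le_pi _
  have h0b : 0 ≤ b := Complex.arg_nonneg_iff.2 (hbot (M + 2) (by omega))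
  have hbpi : b ≤ π := Complex.arg_le_pi _
  have hE0 : E (M + 2) = (((a - b - π : ℝ)) : Angle).toReal := by
    simp only [hE]
    rw [hz4, hz3']
    have hM0 : z (M + 2) - z 0 ≠ 0 := sub_ne_zero.2 (hne _ _ (by omega) (by omega) (by omega))
    rw [← neg_sub (z (M + 2)) (z 0), Complex.arg_neg_coe_angle hM0, ← ha, ← hb, Angle.coe_sub,
      Angle.coe_sub]
    congr 1
    abel
  rw [show M + 3 - 1 = M + 2 by omega]
  refine ⟨fun hab => ?_, fun hab => ?_⟩ <;> rw [htot, hE0]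
  · have : (((a - b - π : ℝ)) : Angle) = (((a - b + π : ℝ)) : Angle) := by
      rw [show a - b + π = (a - b - π) + 2 * π by ring, Angle.coe_add, Angle.coe_two_pi, add_zero]
    rw [this, (Angle.toReal_coe_eq_self_iff).2 ⟨by linarith [Real.pi_pos], by linarith⟩]
    ring
  · rw [(Angle.toReal_coe_eq_self_iff).2 ⟨by linarith, by linarith [Real.pi_pos]⟩]
    ring


end Summit.CriticalPhenomena.CardyFormulaZ2.Cruxes.ParafermionPrecompact.KenyonStreamSecondRelation

end
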